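import Literature.Geometry.Symplectic.JSphereFamilyLeafFunction
import Mathlib.Analysis.Calculus.FDeriv.Prod
import Mathlib.Geometry.Manifold.MFDeriv.FDeriv
import Mathlib.Geometry.Manifold.MFDeriv.SpecificFunctions

/-!
# Immersion criterion for the evaluation maps of a deformation family of an embedded sphere
(registered helper `helper_immersionCriterion` of line `cross-cap-laurent`, crux `GromovRecognitionRelEnd`,
item stmt-SmoothPoincare4-11009; it is verbatim the manifold-calculus stub `stub_immersionCriterion`
of the split of the local-foliation fact F1, child item stmt-SmoothPoincare4-16778)

Setting: `X` a smooth `4`-manifold (charts in `EuclideanSpace ℝ (Fin 4)`); `S = (u₀, v₀)` an embedded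
two-chart sphere (`u₀, v₀ : ℂ → X` smooth, `v₀ z = u₀ z⁻¹` off `0`, `u₀` an injective immersion,
`dv₀(0)` injective, `v₀ 0 ∉ range u₀`); `(N, πN)` a trivial-normal-bundle witness: `N` open
`⊇ range u₀ ∪ {v₀ 0}`, `πN : X → ℂ` smooth on `N` with zero set `{y ∈ N | πN y = 0} = range u₀ ∪ {v₀ 0}`;
`(U a, V a)`, `‖a‖ < ε`, a family with `U 0 = u₀`, `V 0 = v₀`, jointly `C^∞` in `(a, z)` on
`ball 0 ε ×ˢ univ`.  Hypotheses: the normal velocity maps `a ↦ πN (U a z)` and `a ↦ πN (V a w)` have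
injective differential at `a = 0`.

Claim (`helper_immersionCriterion`): the evaluation maps `Φ_U (a, z) = U a z` and `Φ_V (a, w) = V a w`
have injective differential at `(0, z)` for every `z`, resp. at `(0, 0)`.  (This is the "linearization
of the statement that the curves near `u` foliate an open subset", Wendl 2018, proof of Prop. 2.53,
p. 66; here it is pure manifold calculus, the `J`-holomorphy hypotheses are not used.)

Proof (`ImmersionCriterion.injective_mfderiv_of_normalVelocity`, applied twice).  Fix `z`, let
`L = dΦ_{(0,z)}` and suppose `L (α, ζ) = 0`.  By linearity `L (α, ζ) = L (α, 0) + L (0, ζ)`.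
(i) `a`-slice (chain rule, `ImmersionCriterion.fderiv_paramSlice_apply`):
`D(πN ∘ Φ(·, z))(0) α = dπN (L (α, 0))`.
(ii) `z`-slice (`Literature.Geometry.Symplectic.mfderiv_slice_apply`): `d(Φ(0, ·))_z ζ = L (0, ζ)`,
and `Φ (0, ·) = s` is the sphere chart (`u₀`, resp. `v₀`).
(iii) `πN ∘ s ≡ 0` (the sphere lies in the zero set of `πN`), so by the chain rule
`dπN ∘ ds_z = d(πN ∘ s)_z = 0`, i.e. `dπN (L (0, ζ)) = 0`.
(iv) Hence `0 = dπN (L (α, ζ)) = D(πN ∘ Φ(·, z))(0) α`, so `α = 0` by the injectivity hypothesis;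
then `L (0, ζ) = ds_z ζ = 0`, so `ζ = 0` since `s` is immersed at `z`.

References: C. Wendl, *Holomorphic Curves in Low Dimensions*, LNM 2216 (2018), Prop. 2.53 (proof,
p. 65–66); J. M. Lee, *Introduction to Smooth Manifolds*, 2nd ed. (2013), Prop. 3.6 (chain rule).
No new definitions, notation or instances.
-/

open scoped Manifold ContDiff Topology
open Set Function Filter Literature.Geometry.Symplectic

-- the prescribed namespace `Summit.<P>.<Sub>.…` duplicates `SmoothPoincare4` (P = Sub)
set_option linter.dupNamespace false

namespace Summit.SmoothPoincare4.SmoothPoincare4.Theorems.GromovRecognitionRelEnd.CrossCapLaurent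

namespace ImmersionCriterion

variable {X : Type} [TopologicalSpace X] [ChartedSpace (EuclideanSpace ℝ (Fin 4)) X]

/-- **Chain rule for a parameter slice.** For `Φ : ℂ × ℂ → X` differentiable at `(a, z)` and
`πN : X → ℂ` differentiable at `Φ (a, z)`, the flat derivative of `b ↦ πN (Φ (b, z))` at `a` is
`D(πN ∘ Φ(·, z))(a) α = dπN_{Φ (a, z)} (dΦ_{(a, z)} (α, 0))`. [folklore; Lee 2013, Prop. 3.6] -/
theorem fderiv_paramSlice_apply {Φ : ℂ × ℂ → X} {πN : X → ℂ} {a z : ℂ}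
    (hΦd : MDifferentiableAt 𝓘(ℝ, ℂ × ℂ) (𝓡 4) Φ (a, z))
    (hπd : MDifferentiableAt (𝓡 4) 𝓘(ℝ, ℂ) πN (Φ (a, z))) (α : ℂ) :
    fderiv ℝ (fun b : ℂ => πN (Φ (b, z))) a α =
      mfderiv (𝓡 4) 𝓘(ℝ, ℂ) πN (Φ (a, z))
        (mfderiv 𝓘(ℝ, ℂ × ℂ) (𝓡 4) Φ (a, z) (α, (0 : ℂ))) := by
  -- adapted from `Literature.Geometry.Symplectic.mfderiv_slice_apply` (the `z`-slice, with `inr`)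
  have h1 : HasMFDerivAt 𝓘(ℝ, ℂ) 𝓘(ℝ, ℂ × ℂ) (fun b : ℂ => (b, z)) a
      (ContinuousLinearMap.inl ℝ ℂ ℂ) :=
    (hasFDerivAt_prodMk_left (𝕜 := ℝ) a z).hasMFDerivAt
  have h2 : HasMFDerivAt 𝓘(ℝ, ℂ) (𝓡 4) (Φ ∘ fun b : ℂ => (b, z)) a
      ((mfderiv 𝓘(ℝ, ℂ × ℂ) (𝓡 4) Φ (a, z)).comp (ContinuousLinearMap.inl ℝ ℂ ℂ)) :=
    hΦd.hasMFDerivAt.comp a h1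
  have h3 : HasMFDerivAt 𝓘(ℝ, ℂ) 𝓘(ℝ, ℂ) (πN ∘ (Φ ∘ fun b : ℂ => (b, z))) a
      ((mfderiv (𝓡 4) 𝓘(ℝ, ℂ) πN (Φ (a, z))).comp
        ((mfderiv 𝓘(ℝ, ℂ × ℂ) (𝓡 4) Φ (a, z)).comp (ContinuousLinearMap.inl ℝ ℂ ℂ))) :=
    hπd.hasMFDerivAt.comp a h2
  rw [← mfderiv_eq_fderiv,
    show (fun b : ℂ => πN (Φ (b, z))) = πN ∘ (Φ ∘ fun b : ℂ => (b, z)) from rfl, h3.mfderiv]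
  rfl

/-- **Abstract immersion criterion.** Let `Φ : ℂ × ℂ → X` be `C^∞` on `ball 0 ε ×ˢ univ` (`0 < ε`),
`πN : X → ℂ` differentiable at `Φ (0, z)`, and let the slice `Φ (0, ·) = s` be immersed at `z` with
`πN ∘ s ≡ 0`.  If the normal velocity map `a ↦ πN (Φ (a, z))` has injective flat derivative at `0`,
then `dΦ_{(0, z)}` is injective: from `dΦ (α, ζ) = 0`, applying `dπN` kills the slice part
(`dπN ∘ ds = d(πN ∘ s) = 0`) and leaves `D(πN ∘ Φ(·, z))(0) α = 0`, so `α = 0`, and then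
`ds_z ζ = dΦ (0, ζ) = 0` gives `ζ = 0`. [cite: Wendl2018, Prop. 2.53 (proof, p. 66)] -/
theorem injective_mfderiv_of_normalVelocity {ε : ℝ} {Φ : ℂ × ℂ → X} {πN : X → ℂ} {s : ℂ → X}
    {z : ℂ} (hε : 0 < ε) (hΦ : ContMDiffOn 𝓘(ℝ, ℂ × ℂ) (𝓡 4) ∞ Φ (Metric.ball 0 ε ×ˢ univ))
    (hπd : MDifferentiableAt (𝓡 4) 𝓘(ℝ, ℂ) πN (Φ (0, z)))
    (hs : ∀ ζ : ℂ, Φ (0, ζ) = s ζ)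
    (hsinj : Injective (mfderiv 𝓘(ℝ, ℂ) (𝓡 4) s z))
    (hπs : ∀ ζ : ℂ, πN (s ζ) = 0)
    (hD : Injective (fderiv ℝ (fun a : ℂ => πN (Φ (a, z))) 0)) :
    Injective (mfderiv 𝓘(ℝ, ℂ × ℂ) (𝓡 4) Φ (0, z)) := by
  obtain rfl : (fun ζ : ℂ => Φ (0, ζ)) = s := funext hs
  have h0 : ‖(0 : ℂ)‖ < ε := by simpa using hε
  have hΦd : MDifferentiableAt 𝓘(ℝ, ℂ × ℂ) (𝓡 4) Φ (0, z) :=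
    (hΦ.contMDiffAt ((isOpen_paramDomain ε).mem_nhds (mem_paramDomain h0))).mdifferentiableAt
      (by simp)
  -- the slice `Φ (0, ·)` is differentiable at `z`
  have hsd : MDifferentiableAt 𝓘(ℝ, ℂ) (𝓡 4) (fun ζ : ℂ => Φ (0, ζ)) z :=
    (hΦ.comp_contMDiff (contDiff_prodMk_right (0 : ℂ)).contMDiff
      fun _ => mem_paramDomain h0).mdifferentiableAt (by simp)
  -- (iii) `πN ∘ Φ (0, ·) ≡ 0`, hence `dπN ∘ d(Φ (0, ·))_z = 0`
  have hconst : (πN ∘ fun ζ : ℂ => Φ (0, ζ)) = fun _ => (0 : ℂ) := funext fun ζ => hπs ζ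
  have hB' : (mfderiv (𝓡 4) 𝓘(ℝ, ℂ) πN (Φ (0, z))).comp
      (mfderiv 𝓘(ℝ, ℂ) (𝓡 4) (fun ζ : ℂ => Φ (0, ζ)) z) = 0 := by
    rw [← mfderiv_comp z hπd hsd, hconst, mfderiv_const]
    rfl
  -- ... read through the `z`-slice formula `d(Φ (0, ·))_z ζ = dΦ_{(0, z)} (0, ζ)`
  have hB : ∀ ζ : ℂ, mfderiv (𝓡 4) 𝓘(ℝ, ℂ) πN (Φ (0, z))
      (mfderiv 𝓘(ℝ, ℂ × ℂ) (𝓡 4) Φ (0, z) ((0 : ℂ), ζ)) = 0 := fun ζ => by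
    have h : mfderiv (𝓡 4) 𝓘(ℝ, ℂ) πN (Φ (0, z))
        (mfderiv 𝓘(ℝ, ℂ) (𝓡 4) (fun ζ : ℂ => Φ (0, ζ)) z ζ) = 0 := DFunLike.congr_fun hB' ζ
    rw [mfderiv_slice_apply hΦ h0 ζ] at h
    exact h
  -- (i) the `a`-slice
  have hA : ∀ α : ℂ, fderiv ℝ (fun a : ℂ => πN (Φ (a, z))) 0 α =
      mfderiv (𝓡 4) 𝓘(ℝ, ℂ) πN (Φ (0, z))
        (mfderiv 𝓘(ℝ, ℂ × ℂ) (𝓡 4) Φ (0, z) (α, (0 : ℂ))) :=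
    fderiv_paramSlice_apply hΦd hπd
  -- (iv) conclusion
  refine (injective_iff_map_eq_zero _).2 ?_
  rintro ⟨α, ζ⟩ h
  have hsplit : mfderiv 𝓘(ℝ, ℂ × ℂ) (𝓡 4) Φ (0, z) (α, ζ) =
      mfderiv 𝓘(ℝ, ℂ × ℂ) (𝓡 4) Φ (0, z) (α, (0 : ℂ)) +
        mfderiv 𝓘(ℝ, ℂ × ℂ) (𝓡 4) Φ (0, z) ((0 : ℂ), ζ) := by
    rw [← map_add]
    congr 1
    exact Prod.ext (add_zero α).symm (zero_add ζ).symm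
  have hα0 : fderiv ℝ (fun a : ℂ => πN (Φ (a, z))) 0 α = 0 := by
    have h' := congrArg (mfderiv (𝓡 4) 𝓘(ℝ, ℂ) πN (Φ (0, z))) h
    rw [map_zero, hsplit, map_add, hB ζ, add_zero] at h'
    rw [hA α]
    exact h'
  obtain rfl : α = 0 := (injective_iff_map_eq_zero _).1 hD α hα0
  have hζ0 : mfderiv 𝓘(ℝ, ℂ) (𝓡 4) (fun ζ : ℂ => Φ (0, ζ)) z ζ = 0 := by
    rw [mfderiv_slice_apply hΦ h0 ζ]
    exact h
  obtain rfl : ζ = 0 := (injective_iff_map_eq_zero _).1 hsinj ζ hζ0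
  rfl

end ImmersionCriterion

open ImmersionCriterion

/-- **Immersion criterion for the evaluation maps** (stub `stub_immersionCriterion` of the split of
the local-foliation fact, Wendl 2018 Prop. 2.53, proof p. 66: "the linearization of the statement
that the curves near `u` foliate an open subset").  For an embedded two-chart sphere `(u₀, v₀)` in a
smooth `4`-manifold with trivial-normal-bundle witness `(N, πN)` and a jointly smooth family
`(U a, V a)`, `‖a‖ < ε`, through it (`U 0 = u₀`, `V 0 = v₀`): if the normal velocity maps
`a ↦ πN (U a z)` and `a ↦ πN (V a w)` have injective differential at `a = 0`, then
`(a, z) ↦ U a z` has injective differential at every `(0, z)` and `(a, w) ↦ V a w` at `(0, 0)`.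
Two applications of `ImmersionCriterion.injective_mfderiv_of_normalVelocity` (slices `u₀` at `z`,
resp. `v₀` at `0`; `πN ∘ u₀ ≡ 0 ≡ πN ∘ v₀` from the zero-set identity).  The `J`-holomorphy,
Hausdorff/second-countability, injectivity-of-`u₀` and submersion hypotheses are carried but unused.
[cite: Wendl2018, Prop. 2.53] -/
theorem helper_immersionCriterion : ∀ (X : Type) [TopologicalSpace X] [T2Space X] [SecondCountableTopology X] [ChartedSpace (EuclideanSpace ℝ (Fin 4)) X] [IsManifold (𝓡 4) ∞ X] (JX : Literature.Geometry.Symplectic.AlmostComplexStructure (𝓡 4) ∞ X) (u₀ v₀ : ℂ → X) (N : Set X) (πN : X → ℂ), ContMDiff 𝓘(ℝ, ℂ) (𝓡 4) ∞ u₀ → ContMDiff 𝓘(ℝ, ℂ) (𝓡 4) ∞ v₀ → (∀ z : ℂ, z ≠ 0 → v₀ z = u₀ z⁻¹) → Literature.Geometry.Symplectic.IsJHolomorphic (𝓡 4) (fun y => JX y) u₀ → Literature.Geometry.Symplectic.IsJHolomorphic (𝓡 4) (fun y => JX y) v₀ → Function.Injective u₀ → (∀ z, Function.Injective (mfderiv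 𝓘(ℝ, ℂ) (𝓡 4) u₀ z)) → Function.Injective (mfderiv 𝓘(ℝ, ℂ) (𝓡 4) v₀ 0) → v₀ 0 ∉ Set.range u₀ → IsOpen N → Set.range u₀ ∪ {v₀ 0} ⊆ N → ContMDiffOn (𝓡 4) 𝓘(ℝ, ℂ) ∞ πN N → (∀ y ∈ N, Function.Surjective (mfderiv (𝓡 4) 𝓘(ℝ, ℂ) πN y)) → {y | y ∈ N ∧ πN y = 0} = Set.range u₀ ∪ {v₀ 0} → ∀ (ε : ℝ) (U V : ℂ → ℂ → X), 0 < ε → (∀ z, U 0 z = u₀ z) → (∀ w, V 0 w = v₀ w) → (∀ a : ℂ, ‖a‖ < ε → (∀ z : ℂ, z ≠ 0 → V a z = U a z⁻¹) ∧ Literature.Geometry.Symplectic.IsJHolomorphic (𝓡 4) (fun y => JX y) (U a) ∧ Literature.Geometry.Symplectic.IsJHolomorphic (𝓡 4) (fun y => JX y) (V a)) → ContMDiffOn 𝓘(ℝ, ℂ × ℂ) (𝓡 4) ∞ (fun q : ℂ × ℂ => U q.1 q.2) (Metric.ball 0 ε ×ˢ Set.univ) → ContMDiffOn 𝓘(ℝ,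 ℂ × ℂ) (𝓡 4) ∞ (fun q : ℂ × ℂ => V q.1 q.2) (Metric.ball 0 ε ×ˢ Set.univ) → (∀ z, Function.Injective (fderiv ℝ (fun a : ℂ => πN (U a z)) 0)) → (∀ w, Function.Injective (fderiv ℝ (fun a : ℂ => πN (V a w)) 0)) → (∀ z, Function.Injective (mfderiv 𝓘(ℝ, ℂ × ℂ) (𝓡 4) (fun q : ℂ × ℂ => U q.1 q.2) (0, z))) ∧ Function.Injective (mfderiv 𝓘(ℝ, ℂ × ℂ) (𝓡 4) (fun q : ℂ × ℂ => V q.1 q.2) (0, 0)) := by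
  intro X _ _ _ _ _ _JX u₀ v₀ N πN _hu₀ _hv₀ huv₀ _hJu₀ _hJv₀ _hinj himm₀ himmv _hnot hN hsub hπ _hπs
    hzero ε U V hε hU0 hV0 _hleaf hUs hVs hDU hDV
  -- `πN` vanishes on the sphere
  have hπu : ∀ ζ : ℂ, πN (u₀ ζ) = 0 := fun ζ => by
    have h : u₀ ζ ∈ {y | y ∈ N ∧ πN y = 0} := by
      rw [hzero]
      exact Or.inl (mem_range_self ζ)
    exact h.2
  have hπv : ∀ w : ℂ, πN (v₀ w) = 0 := fun w => by
    have h : v₀ w ∈ {y | y ∈ N ∧ πN y = 0} := by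
      rw [hzero]
      by_cases hw : w = 0
      · subst hw
        exact Or.inr rfl
      · exact Or.inl ⟨w⁻¹, (huv₀ w hw).symm⟩
    exact h.2
  -- `πN` is differentiable at the base points `U 0 z = u₀ z ∈ N` and `V 0 0 = v₀ 0 ∈ N`
  have hπdU : ∀ z : ℂ, MDifferentiableAt (𝓡 4) 𝓘(ℝ, ℂ) πN (U 0 z) := fun z => by
    have hmem : U 0 z ∈ N := by
      rw [hU0]
      exact hsub (Or.inl (mem_range_self z))
    exact (hπ.contMDiffAt (hN.mem_nhds hmem)).mdifferentiableAt (by simp)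
  have hπdV : MDifferentiableAt (𝓡 4) 𝓘(ℝ, ℂ) πN (V 0 0) := by
    have hmem : V 0 0 ∈ N := by
      rw [hV0]
      exact hsub (Or.inr rfl)
    exact (hπ.contMDiffAt (hN.mem_nhds hmem)).mdifferentiableAt (by simp)
  exact ⟨fun z => injective_mfderiv_of_normalVelocity (Φ := fun q : ℂ × ℂ => U q.1 q.2) (s := u₀)
      (z := z) hε hUs (hπdU z) hU0 (himm₀ z) hπu (hDU z),
    injective_mfderiv_of_normalVelocity (Φ := fun q : ℂ × ℂ => V q.1 q.2) (s := v₀) (z := 0)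
      hε hVs hπdV hV0 himmv hπv (hDV 0)⟩

end Summit.SmoothPoincare4.SmoothPoincare4.Theorems.GromovRecognitionRelEnd.CrossCapLaurent
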